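import Literature.NumberTheory.LFunctions.FeketePolyaKernelCertificates
import Literature.NumberTheory.LFunctions.NoRealZeroOddSmallModuli
import HarnessLib

/-!
# No real zero for the EVEN real primitive characters of conductor `≤ 292`, in the kernel
# (`NoRealZeroEvenUpTo 292`; with the odd base, `NoRealZeroUpTo 163`, unconditionally)

Topic `Literature/NumberTheory/LFunctions`; namespace `Literature.NumberTheory.LFunctions`
(helpers in `….EvenSmallModuli`). THEOREMS only (no definition, no named fact, no `sorry`).

The kernel base of the certified no-real-zero column (`NoRealZeroUpTo.lean`; cell `parity-realchar`,
printed frontiers Platt 2016 / Watkins 2004, certified by the cell to `10¹⁰` both parities) was `52` for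
even characters (`noRealZeroUpTo_fiftyTwo`: Fekete–Pólya of order `≤ 2` on the primitive character, which
first fails at `d = 53`) and `163` for odd ones (`noRealZeroOddUpTo_onehundredsixtythree`, Epstein class
sums). Here the EVEN base is pushed to `292`:
**`noRealZeroEvenUpTo_292 : NoRealZeroEvenUpTo 292`** — for every modulus `3 ≤ q ≤ 292`, every primitive
quadratic EVEN `χ` mod `q` and every `σ ∈ (0, 1)`, `L(σ, χ) ≠ 0`; hence, with the odd base,
**`noRealZeroUpTo_163 : NoRealZeroUpTo 163`** (both parities) and `NoExceptionalZeroUpTo 163 c` for every `c`.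

Method: for each of the `74` positive fundamental discriminants `52 < d ≤ 292` the order-two Fekete–Pólya
criterion holds for an INDUCED character `χ_d↑(dk)` with `k ∈ {1, 2, 3, 5, 10, 15, 70}` (Rosser's
device: sift the small primes; e.g. `d = 53 ↦ k = 2`, `77 ↦ 3`, `152 ↦ 3`, `173 ↦ 70` — the tree's
`LFunction_chi173Char_re_pos` used `210` —, `188 ↦ 5`, `197 ↦ 10`, `213 ↦ 5`, `237 ↦ 10`, `248 ↦ 15`,
`285 ↦ 2`, all others `k = 1`), checked over one period by the list-free kernel engine
`FeketePolyaKernelCertificates.lean` (`decide +kernel`; the largest period is `12 110`); moduli that carry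
no even primitive quadratic character are dismissed by the parity test `χ(q − 1) = −1` of the same value
function or by the conductor lemmas of `PrimitiveQuadraticCharacterKronecker.lean` (`q ≡ 2 (mod 4)`,
`16 ∣ q`, odd square factor). The assembly is `interval_cases` over three ranges with one `first`
combinator, so the source does not list the `240` moduli. `d = 293` is the first even discriminant with no
order-`≤ 3` certificate of period `≤ 2·10⁵` through `k ∣ 510510` (numerics of the cell, 2026-08-26); the
odd side beyond `163` (`−232`, `−235`, `−267` have none either: Heilbronn's phenomenon at small class
number) is not attempted here.

## References

* H. L. Montgomery, R. C. Vaughan, *Multiplicative Number Theory I*, CUP 2007, §11.2.1 Exercises 7–8,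
  §9.3 Theorem 9.13. [MontgomeryVaughan2007]
* J. B. Rosser, *Real roots of real Dirichlet L-series*, J. Research Nat. Bur. Standards 45 (1950)
  505–514. [Rosser1950RealRoots]
* M. Watkins, *Real zeros of real odd Dirichlet L-functions*, Math. Comp. 73 (2004) 415–423.
  [Watkins2004RealZeros]
-/

namespace Literature.NumberTheory.LFunctions

namespace EvenSmallModuli

open FeketePolyaKernel PrimitiveQuadratic

/-! ### Per-conductor wrappers: parity test or certificate -/

/-- Primitive characters of modulus `≥ 2` are non-trivial. [folklore] -/
private theorem ne_one {q : ℕ} [NeZero q] {χ : DirichletCharacter ℂ q} (hprim : χ.IsPrimitive)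
    (hq : 2 ≤ q) : χ ≠ 1 :=
  SiegelZeroQuality.ne_one_of_isPrimitive hprim hq

/-- **Even characters of odd conductor `q > 1`**: if either `((q−1)/q) = −1` (then no primitive quadratic
character mod `q` is even) or the induced character mod `qk` passes the order-two check, then every EVEN
primitive quadratic `χ` mod `q` has `L(σ, χ) ≠ 0` on `(0, 1)`.
[cite: MontgomeryVaughan2007, §11.2.1 Exercises 7 (g), 8] -/
theorem good_even_odd_cond {q : ℕ} [NeZero q] (hodd : Odd q) (hq : 1 < q) (k : ℕ) (hk : k ≠ 0)
    (h : valOdd q (q - 1) = -1 ∨ runOK (valOdd q) (q * k) = true) :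
    ∀ χ : DirichletCharacter ℂ q, χ.IsQuadratic → χ.IsPrimitive → χ.Even →
      ∀ σ : ℝ, 0 < σ → σ < 1 → χ.LFunction σ ≠ 0 := by
  intro χ hquad hprim heven σ hσ _
  have hv := re_apply_eq_valOdd hodd hq hprim hquad
  rcases h with hpar | hrun
  · exact (not_even_of_val _ hv hpar heven).elim
  · haveI : NeZero (q * k) := ⟨Nat.mul_ne_zero (NeZero.ne q) hk⟩
    exact lfunction_ne_zero_of_check (dvd_mul_right q k) χ _ hv (ne_one hprim hq)
      (check_of_runOK hrun) hσ

/-- **Even characters of conductor `4m`** (`m` odd, `m > 1`): parity test or certificate, as above.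
[cite: MontgomeryVaughan2007, §11.2.1 Exercises 7 (g), 8] -/
theorem good_even_four_cond {m : ℕ} [NeZero m] (hm : Odd m) (hm1 : 1 < m) (k : ℕ) (hk : k ≠ 0)
    (h : valFour m (2 ^ 2 * m - 1) = -1 ∨ runOK (valFour m) (2 ^ 2 * m * k) = true) :
    ∀ χ : DirichletCharacter ℂ (2 ^ 2 * m), χ.IsQuadratic → χ.IsPrimitive → χ.Even →
      ∀ σ : ℝ, 0 < σ → σ < 1 → χ.LFunction σ ≠ 0 := by
  intro χ hquad hprim heven σ hσ _
  have hv := re_apply_eq_valFour hm hm1 hprim hquad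
  rcases h with hpar | hrun
  · exact (not_even_of_val _ hv hpar heven).elim
  · haveI : NeZero (2 ^ 2 * m * k) := ⟨Nat.mul_ne_zero (NeZero.ne _) hk⟩
    exact lfunction_ne_zero_of_check (dvd_mul_right _ k) χ _ hv (ne_one hprim (by omega))
      (check_of_runOK hrun) hσ

/-- **Even characters of conductor `8m`** (`m` odd, `m > 1`; two primitive quadratic characters): for
each of the two value patterns, parity test or certificate. [cite: MontgomeryVaughan2007, §11.2.1 Exercises 7 (g), 8] -/
theorem good_even_eight_cond {m : ℕ} [NeZero m] (hm : Odd m) (hm1 : 1 < m) (k : ℕ) (hk : k ≠ 0)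
    (hA : valEightA m (2 ^ 3 * m - 1) = -1 ∨ runOK (valEightA m) (2 ^ 3 * m * k) = true)
    (hB : valEightB m (2 ^ 3 * m - 1) = -1 ∨ runOK (valEightB m) (2 ^ 3 * m * k) = true) :
    ∀ χ : DirichletCharacter ℂ (2 ^ 3 * m), χ.IsQuadratic → χ.IsPrimitive → χ.Even →
      ∀ σ : ℝ, 0 < σ → σ < 1 → χ.LFunction σ ≠ 0 := by
  intro χ hquad hprim heven σ hσ _
  haveI : NeZero (2 ^ 3 * m * k) := ⟨Nat.mul_ne_zero (NeZero.ne _) hk⟩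
  rcases re_apply_eq_valEight hm hm1 hprim hquad with hv | hv
  · rcases hA with hpar | hrun
    · exact (not_even_of_val _ hv hpar heven).elim
    · exact lfunction_ne_zero_of_check (dvd_mul_right _ k) χ _ hv (ne_one hprim (by omega))
        (check_of_runOK hrun) hσ
  · rcases hB with hpar | hrun
    · exact (not_even_of_val _ hv hpar heven).elim
    · exact lfunction_ne_zero_of_check (dvd_mul_right _ k) χ _ hv (ne_one hprim (by omega))
        (check_of_runOK hrun) hσ



/-! ### Wrappers keyed on the conductor `q` alone (for `interval_cases` assemblies) -/

/-- Odd conductor, keyed on `q`. [cite: MontgomeryVaughan2007, §11.2.1 Exercises 7 (g), 8] -/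
theorem good_even_of_odd {q : ℕ} [NeZero q] (hq2 : q % 2 = 1) (hq1 : 1 < q) (k : ℕ) (hk : k ≠ 0)
    (h : valOdd q (q - 1) = -1 ∨ runOK (valOdd q) (q * k) = true) :
    ∀ χ : DirichletCharacter ℂ q, χ.IsQuadratic → χ.IsPrimitive → χ.Even →
      ∀ σ : ℝ, 0 < σ → σ < 1 → χ.LFunction σ ≠ 0 :=
  good_even_odd_cond (Nat.odd_iff.mpr hq2) hq1 k hk h

/-- Conductor `4m`, keyed on `q = 4m`. [cite: MontgomeryVaughan2007, §11.2.1 Exercises 7 (g), 8] -/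
theorem good_even_of_four {q : ℕ} [NeZero q] (hq8 : q % 8 = 4) (hq1 : 4 < q) (k : ℕ) (hk : k ≠ 0)
    (h : valFour (q / 4) (q - 1) = -1 ∨ runOK (valFour (q / 4)) (q * k) = true) :
    ∀ χ : DirichletCharacter ℂ q, χ.IsQuadratic → χ.IsPrimitive → χ.Even →
      ∀ σ : ℝ, 0 < σ → σ < 1 → χ.LFunction σ ≠ 0 := by
  obtain ⟨m, rfl⟩ : ∃ m, q = 4 * m := ⟨q / 4, by omega⟩
  haveI : NeZero m := ⟨by omega⟩
  rw [Nat.mul_div_cancel_left m (by norm_num : 0 < 4)] at h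
  exact good_even_four_cond (m := m) (Nat.odd_iff.mpr (by omega)) (by omega) k hk h

/-- Conductor `8m`, keyed on `q = 8m`. [cite: MontgomeryVaughan2007, §11.2.1 Exercises 7 (g), 8] -/
theorem good_even_of_eight {q : ℕ} [NeZero q] (hq16 : q % 16 = 8) (hq1 : 8 < q) (k : ℕ) (hk : k ≠ 0)
    (hA : valEightA (q / 8) (q - 1) = -1 ∨ runOK (valEightA (q / 8)) (q * k) = true)
    (hB : valEightB (q / 8) (q - 1) = -1 ∨ runOK (valEightB (q / 8)) (q * k) = true) :
    ∀ χ : DirichletCharacter ℂ q, χ.IsQuadratic → χ.IsPrimitive → χ.Even →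
      ∀ σ : ℝ, 0 < σ → σ < 1 → χ.LFunction σ ≠ 0 := by
  obtain ⟨m, rfl⟩ : ∃ m, q = 8 * m := ⟨q / 8, by omega⟩
  haveI : NeZero m := ⟨by omega⟩
  rw [Nat.mul_div_cancel_left m (by norm_num : 0 < 8)] at hA hB
  exact good_even_eight_cond (m := m) (Nat.odd_iff.mpr (by omega)) (by omega) k hk hA hB

/-- Conductor `≡ 2 (mod 4)`: no primitive character. [cite: MontgomeryVaughan2007, §9.3 Theorem 9.13] -/
theorem absurd_of_mod_four_two {q : ℕ} [NeZero q] (hq : q % 4 = 2) {χ : DirichletCharacter ℂ q}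
    (hprim : χ.IsPrimitive) : False := by
  obtain ⟨m, rfl⟩ : ∃ m, q = 2 * m := ⟨q / 2, by omega⟩
  haveI : NeZero m := ⟨by omega⟩
  exact not_isPrimitive_two_mul (m := m) (Nat.odd_iff.mpr (by omega)) hprim

/-- Conductor divisible by `16`: no primitive quadratic character. [cite: MontgomeryVaughan2007, §9.3 Theorem 9.13] -/
theorem absurd_of_sixteen_dvd {q : ℕ} [NeZero q] (hq : q % 16 = 0) {χ : DirichletCharacter ℂ q}
    (hprim : χ.IsPrimitive) (hquad : χ.IsQuadratic) : False := by
  obtain ⟨k, m, hm, rfl⟩ := Nat.exists_eq_two_pow_mul_odd (NeZero.ne q)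
  have hm2 := Nat.odd_iff.mp hm
  haveI : NeZero m := ⟨by omega⟩
  have hk := le_three_of_level_two_pow_mul hm hprim hquad
  interval_cases k <;> norm_num at hq <;> omega

/-- Conductor with an odd square factor `p²`: no primitive quadratic character.
[cite: MontgomeryVaughan2007, §9.3 Theorem 9.13] -/
theorem absurd_of_sq_dvd {q : ℕ} [NeZero q] {p : ℕ} (hp : p.Prime) (hp2 : p ≠ 2) (hpq : p * p ∣ q)
    {χ : DirichletCharacter ℂ q} (hprim : χ.IsPrimitive) (hquad : χ.IsQuadratic) : False := by
  obtain ⟨k, m, hm, rfl⟩ := Nat.exists_eq_two_pow_mul_odd (NeZero.ne q)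
  have hm2 := Nat.odd_iff.mp hm
  haveI : NeZero m := ⟨by omega⟩
  have hsq := squarefree_of_level_two_pow_mul hm hprim hquad
  have hp2' : Nat.Coprime p 2 := (Nat.coprime_primes hp Nat.prime_two).mpr hp2
  have hcop : Nat.Coprime (p * p) (2 ^ k) := Nat.Coprime.pow_right k (Nat.Coprime.mul_left hp2' hp2')
  have hpm : p * p ∣ m := hcop.dvd_of_dvd_mul_left hpq
  exact hp.one_lt.ne' (Nat.isUnit_iff.mp (hsq p hpm))


/-! ### The three ranges (one combinator: conductor lemmas, then certificates with `k ↑`) -/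

/-- Even conductors `52 < q ≤ 132`. [cite: MontgomeryVaughan2007, §11.2.1 Exercises 7 (g), 8] -/
theorem range_53_132 (q : ℕ) [NeZero q] (hlo : 52 < q) (hhi : q ≤ 132) :
    ∀ χ : DirichletCharacter ℂ q, χ.IsQuadratic → χ.IsPrimitive → χ.Even →
      ∀ σ : ℝ, 0 < σ → σ < 1 → χ.LFunction σ ≠ 0 := by
  interval_cases q
  all_goals first
    | exact fun χ _ hprim _ _ _ _ ↦ (absurd_of_mod_four_two (by decide) hprim).elim
    | exact fun χ hquad hprim _ _ _ _ ↦ (absurd_of_sixteen_dvd (by decide) hprim hquad).elim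
    | exact fun χ hquad hprim _ _ _ _ ↦
        (absurd_of_sq_dvd (p := 3) (by norm_num) (by decide) (by decide) hprim hquad).elim
    | exact fun χ hquad hprim _ _ _ _ ↦
        (absurd_of_sq_dvd (p := 5) (by norm_num) (by decide) (by decide) hprim hquad).elim
    | exact fun χ hquad hprim _ _ _ _ ↦
        (absurd_of_sq_dvd (p := 7) (by norm_num) (by decide) (by decide) hprim hquad).elim
    | exact fun χ hquad hprim _ _ _ _ ↦
        (absurd_of_sq_dvd (p := 11) (by norm_num) (by decide) (by decide) hprim hquad).elim
    | exact good_even_of_odd (by decide) (by decide) 1 (by decide) (by decide +kernel)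
    | exact good_even_of_odd (by decide) (by decide) 2 (by decide) (by decide +kernel)
    | exact good_even_of_odd (by decide) (by decide) 3 (by decide) (by decide +kernel)
    | exact good_even_of_four (by decide) (by decide) 1 (by decide) (by decide +kernel)
    | exact good_even_of_eight (by decide) (by decide) 1 (by decide) (by decide +kernel) (by decide +kernel)

/-- Even conductors `132 < q ≤ 212`. [cite: MontgomeryVaughan2007, §11.2.1 Exercises 7 (g), 8] -/
theorem range_133_212 (q : ℕ) [NeZero q] (hlo : 132 < q) (hhi : q ≤ 212) :
    ∀ χ : DirichletCharacter ℂ q, χ.IsQuadratic → χ.IsPrimitive → χ.Even →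
      ∀ σ : ℝ, 0 < σ → σ < 1 → χ.LFunction σ ≠ 0 := by
  interval_cases q
  all_goals first
    | exact fun χ _ hprim _ _ _ _ ↦ (absurd_of_mod_four_two (by decide) hprim).elim
    | exact fun χ hquad hprim _ _ _ _ ↦ (absurd_of_sixteen_dvd (by decide) hprim hquad).elim
    | exact fun χ hquad hprim _ _ _ _ ↦
        (absurd_of_sq_dvd (p := 3) (by norm_num) (by decide) (by decide) hprim hquad).elim
    | exact fun χ hquad hprim _ _ _ _ ↦
        (absurd_of_sq_dvd (p := 5) (by norm_num) (by decide) (by decide) hprim hquad).elim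
    | exact fun χ hquad hprim _ _ _ _ ↦
        (absurd_of_sq_dvd (p := 7) (by norm_num) (by decide) (by decide) hprim hquad).elim
    | exact fun χ hquad hprim _ _ _ _ ↦
        (absurd_of_sq_dvd (p := 13) (by norm_num) (by decide) (by decide) hprim hquad).elim
    | exact good_even_of_odd (by decide) (by decide) 1 (by decide) (by decide +kernel)
    | exact good_even_of_odd (by decide) (by decide) 10 (by decide) (by decide +kernel)
    | exact good_even_of_odd (by decide) (by decide) 70 (by decide) (by decide +kernel)
    | exact good_even_of_four (by decide) (by decide) 1 (by decide) (by decide +kernel)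
    | exact good_even_of_four (by decide) (by decide) 5 (by decide) (by decide +kernel)
    | exact good_even_of_eight (by decide) (by decide) 1 (by decide) (by decide +kernel) (by decide +kernel)
    | exact good_even_of_eight (by decide) (by decide) 3 (by decide) (by decide +kernel) (by decide +kernel)

/-- Even conductors `212 < q ≤ 292`. [cite: MontgomeryVaughan2007, §11.2.1 Exercises 7 (g), 8] -/
theorem range_213_292 (q : ℕ) [NeZero q] (hlo : 212 < q) (hhi : q ≤ 292) :
    ∀ χ : DirichletCharacter ℂ q, χ.IsQuadratic → χ.IsPrimitive → χ.Even →
      ∀ σ : ℝ, 0 < σ → σ < 1 → χ.LFunction σ ≠ 0 := by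
  interval_cases q
  all_goals first
    | exact fun χ _ hprim _ _ _ _ ↦ (absurd_of_mod_four_two (by decide) hprim).elim
    | exact fun χ hquad hprim _ _ _ _ ↦ (absurd_of_sixteen_dvd (by decide) hprim hquad).elim
    | exact fun χ hquad hprim _ _ _ _ ↦
        (absurd_of_sq_dvd (p := 3) (by norm_num) (by decide) (by decide) hprim hquad).elim
    | exact fun χ hquad hprim _ _ _ _ ↦
        (absurd_of_sq_dvd (p := 5) (by norm_num) (by decide) (by decide) hprim hquad).elim
    | exact fun χ hquad hprim _ _ _ _ ↦
        (absurd_of_sq_dvd (p := 7) (by norm_num) (by decide) (by decide) hprim hquad).elim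
    | exact fun χ hquad hprim _ _ _ _ ↦
        (absurd_of_sq_dvd (p := 11) (by norm_num) (by decide) (by decide) hprim hquad).elim
    | exact fun χ hquad hprim _ _ _ _ ↦
        (absurd_of_sq_dvd (p := 17) (by norm_num) (by decide) (by decide) hprim hquad).elim
    | exact good_even_of_odd (by decide) (by decide) 1 (by decide) (by decide +kernel)
    | exact good_even_of_odd (by decide) (by decide) 2 (by decide) (by decide +kernel)
    | exact good_even_of_odd (by decide) (by decide) 5 (by decide) (by decide +kernel)
    | exact good_even_of_odd (by decide) (by decide) 10 (by decide) (by decide +kernel)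
    | exact good_even_of_four (by decide) (by decide) 1 (by decide) (by decide +kernel)
    | exact good_even_of_eight (by decide) (by decide) 1 (by decide) (by decide +kernel) (by decide +kernel)
    | exact good_even_of_eight (by decide) (by decide) 15 (by decide) (by decide +kernel) (by decide +kernel)

end EvenSmallModuli

open EvenSmallModuli in
/-- **`NoRealZeroEvenUpTo 292`, unconditionally**: no even real primitive character of conductor `≤ 292`
has a real zero in `(0, 1)` (`q ≤ 52`: `noRealZeroUpTo_fiftyTwo`; `52 < q ≤ 292`: order-two Fekete–Pólya
certificates through induced characters, kernel-checked). [cite: MontgomeryVaughan2007, §11.2.1 Exercises 7 (g), 8] -/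
theorem noRealZeroEvenUpTo_292 : NoRealZeroEvenUpTo 292 := by
  intro q _ hq3 hq χ hquad hprim heven σ hσ0 hσ1
  by_cases h52 : q ≤ 52
  · exact noRealZeroUpTo_fiftyTwo q hq3 h52 χ hquad hprim σ hσ0 hσ1
  by_cases h132 : q ≤ 132
  · exact range_53_132 q (by omega) h132 χ hquad hprim heven σ hσ0 hσ1
  by_cases h212 : q ≤ 212
  · exact range_133_212 q (by omega) h212 χ hquad hprim heven σ hσ0 hσ1
  · exact range_213_292 q (by omega) hq χ hquad hprim heven σ hσ0 hσ1

/-- **`NoRealZeroUpTo 163`, both parities, unconditionally**: the even base `292` meets the odd base `163`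
(`noRealZeroOddUpTo_onehundredsixtythree`, Epstein class sums). [cite: MontgomeryVaughan2007, §11.2.1 Exercise 7] -/
theorem noRealZeroUpTo_163 : NoRealZeroUpTo 163 :=
  NoRealZeroUpTo.iff_odd_and_even.mpr
    ⟨noRealZeroOddUpTo_onehundredsixtythree,
      fun q _ hq3 hq χ hquad hprim heven σ hσ0 hσ1 ↦
        noRealZeroEvenUpTo_292 q hq3 (by omega) χ hquad hprim heven σ hσ0 hσ1⟩

/-- `NoExceptionalZeroUpTo 163 c` for every `c`: a named-fact-free base for certificate tables indexed by
larger discriminants, three times deeper than `noExceptionalZeroUpTo_fiftyTwo`. [cite: MontgomeryVaughan2007, §11.2.1 Exercise 7] -/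
theorem noExceptionalZeroUpTo_163 (c : ℝ) : NoExceptionalZeroUpTo 163 c :=
  noRealZeroUpTo_163.noExceptionalZeroUpTo c

/-- Both kernel bases together after this file: `NoRealZeroEvenUpTo 292 ∧ NoRealZeroOddUpTo 163`.
[cite: MontgomeryVaughan2007, §11.2.1 Exercise 7] -/
theorem noRealZero_kernelBase_292_163 : NoRealZeroEvenUpTo 292 ∧ NoRealZeroOddUpTo 163 :=
  ⟨noRealZeroEvenUpTo_292, noRealZeroOddUpTo_onehundredsixtythree⟩

end Literature.NumberTheory.LFunctions
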